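import Summits.BirchSwinnertonDyer.BirchSwinnertonDyer.Theorems.ResidualThetaTransportAtTwoResidualSignedLambdaLowerCMAtTwoChildBKitSelmer
import Mathlib.Algebra.Module.CharacterModule
import Mathlib.Algebra.Module.TransferInstance
import Mathlib.LinearAlgebra.TensorProduct.Tower
import Mathlib.RingTheory.Localization.FractionRing
import HarnessLib

/-!
# Crux RSL_g `ResidualSignedLambdaLowerCMAtTwo` (stmt-BirchSwinnertonDyer-22608), line `onepair` — KZ_g child B PORT KIT, part 2:
# H-SEL over the pin bundle, H-ISO, the port's `X`-binder and the `μt := 1` arithmetic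

Consumer side of the kernel PORT of the content stub `stub_kzgChildB` (child B body: (ii_fin) the zeta quotient `𝐇¹_Γ(T_ρ) ⧸ Λ_𝒪 z` is torsion
after `Frac 𝒪 ⊗_𝒪 –`, (ii_λ) `λ_𝒪(𝐇¹/Λ_𝒪 z) ≤ λ_𝒪((π.Sel₀)^∨) + λ_𝒪(Λ_𝒪/(μt))`) from the pin-free Literature fact «Kato125AB» (typer lane
«Kato125b»; text of record `KatoValuesQuotientTwoText`, stub-ideation k2-g31, STUB-PLAN rev 33.1 row 113), whose binder `X` is the dual fine Selmer
group pinned by membership in `GreenbergSelmer.fineSelmerInfty (A_ρ) κ` with `𝒪`-action pinned to `scalarH1`, and whose appended clauses are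
(FIN) `Module.Finite (Frac 𝒪) (Frac 𝒪 ⊗ (𝐇¹ ⧸ Λ_𝒪 z))`, (FINX), (LAM) `finrank (Frac 𝒪 ⊗ (𝐇¹ ⧸ Λ_𝒪 z)) ≤ finrank (Frac 𝒪 ⊗ X^∨)` — about the SAME
class `z` for which (BK)/(VAL)/(TRIV) hold (the class child A's port `OnePair.stub_kzgChildA_of_zetaElement` values).

This file proves, sorry-free and definition-free (part 1 = `…ChildBKitSelmer`: H-STAB, fine = locally trivial, the away-from-`2` engine, the
at-`2` Kummer bridge):
* §1 **H-ISO**: `λ_𝒪` and the `Module.Finite (Frac 𝒪 ⊗ –)` clause are invariant under `𝒪`-linear equivalence, also after `CharacterModule`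
  (`lamO_congr`, `lamO_characterModule_congr`, `moduleFinite_baseChange_congr`, `moduleFinite_characterModule_congr`).
* §2 **H-SEL over the pin bundle `π : OnePairPins …`**: membership in the pinned strict-and-primitive `π.Sel₀ ≤ Sg` IS membership in
  `Sel₀(ℚ_∞, A_ρ) = GreenbergSelmer.fineSelmerInfty (CofreeF S ρ) κ` (`mem_Sel₀_iff_mem_fineSelmerInfty`), fine ⟹ signed
  (`mem_plusSelmerSet_of_mem_fineSelmerInfty`), and the port's `hX` binder for `X :=` the image of `π.Sel₀` in `H¹(Γ_∞, A_ρ)`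
  (`exists_Sel₀_coe_eq_iff_mem_fineSelmerInfty`, `mem_map_Sel₀_iff_mem_fineSelmerInfty`) — hypotheses: `κ` cyclotomic, `S₀ ∌ 2`, `hSg` only.
* §3 **the port's `X`-binder**: an `𝒪`-module structure on that image with the `hXO` compatibility and an `𝒪`-linear equivalence with `↥π.Sel₀`
  EXISTS (`exists_module_map_Sel₀`, stated as an existence so that no definition is introduced), and for ANY admissible `X` the identification
  `λ_𝒪(X^∨) = λ_𝒪((π.Sel₀)^∨)` (`nonempty_linearEquiv_Sel₀_of_mem_iff`, `lamO_characterModule_eq_of_mem_iff`).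
* §4 **the `μt := 1` arithmetic** (k2-g31 B1–B4): `λ_𝒪(𝐇¹/Λ z)` is definitionally the (FIN)/(LAM) left-hand side, `λ_𝒪(Λ_𝒪 ⧸ (1)) = 0`, and the
  ADAPTER `childB_clauses_of_fin_lam`: (FIN) ∧ (LAM) for `z` and an admissible `X` ⟹ child B's two clauses at `(z, μt := 1)`.

With parts 1–2 the port of the merged fact is: `obtain ⟨inst, hXO, ⟨e⟩⟩ := exists_module_map_Sel₀ …`, feed `X`, `hXO`,
`mem_map_Sel₀_iff_mem_fineSelmerInfty` to the fact, and close with `childB_clauses_of_fin_lam` (stub-critic Q174; k2-g31 Plan 2; k2-g33 Plan 1).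
§1–§2 adapted from the stub-ideation sketch `Cruxes/ResidualThetaCountLowerPureAtTwo/Sketch_sidea_k2_g33.lean` (sidea k2 g33), §4 from
`Sketch_sidea_k2_g31.lean` (sidea k2 g31); neither was ever proposed. BSD is NOT proved by any of this; RSL_g 22608 stays OPEN (print residue:
child B body, Kato 12.5 (1) fact, LVsq), KZ_g 24105 HELD; «Kato125AB» is an unproved named fact still to be typed.

References: Kato 2004 Thm. 12.5 (2) (p. 222), §13.8 (p. 228); Burungale–Tian 2026 Thm. 2.6; Greenberg 1989 §1 p. 98; Kobayashi 2003 Def. 1.1.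
-/

set_option autoImplicit false
set_option linter.dupNamespace false

noncomputable section

open scoped Classical TensorProduct

-- the Theorems namespace of this sub repeats the summit name by design (D-0017 nested layout)
namespace Summit.BirchSwinnertonDyer.BirchSwinnertonDyer.Theorems.OnePair.ChildBKit

open NumberField IsDedekindDomain Field
open Literature.NumberTheory.EllipticCurves Literature.NumberTheory.EllipticCurves.GreenbergSelmer
  Literature.NumberTheory.EllipticCurves.GreenbergVatsal2000 Literature.NumberTheory.GaloisRepresentations
open Summit.BirchSwinnertonDyer.BirchSwinnertonDyer.Theorems Literature.NumberTheory.EllipticCurves.Kobayashi2003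

/-! ## §1 H-ISO — `λ_𝒪` is invariant under `𝒪`-linear equivalence -/

section HIso

variable {p : ℕ} [Fact p.Prime] (S : Set (PadicAlgCl p))

/-- **H-ISO.** `λ_𝒪(X) = λ_𝒪(Y)` for `X ≃ₗ[𝒪] Y` (`Frac 𝒪 ⊗_𝒪 –` is a functor; `LinearEquiv.finrank_eq`). [cite: Kato2004Asterisque, §13.8 (p. 228)] -/
theorem lamO_congr {X Y : Type*} [AddCommGroup X] [Module (coeffO S) X] [AddCommGroup Y] [Module (coeffO S) Y]
    (e : X ≃ₗ[coeffO S] Y) : lamO S X = lamO S Y :=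
  LinearEquiv.finrank_eq (LinearEquiv.baseChange (coeffO S) (FractionRing (coeffO S)) X Y e)

/-- **H-ISO for Pontryagin duals.** `λ_𝒪(X^∨) = λ_𝒪(Y^∨)` for `X ≃ₗ[𝒪] Y` (`CharacterModule.congr`). [cite: Kato2004Asterisque, §13.8 (p. 228)] -/
theorem lamO_characterModule_congr {X Y : Type*} [AddCommGroup X] [Module (coeffO S) X] [AddCommGroup Y]
    [Module (coeffO S) Y] (e : X ≃ₗ[coeffO S] Y) : lamO S (CharacterModule X) = lamO S (CharacterModule Y) :=
  lamO_congr S (CharacterModule.congr e)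

/-- The `Module.Finite (Frac 𝒪 ⊗ –)` clause transports along an `𝒪`-linear equivalence. [cite: Kato2004Asterisque, §13.8 (p. 228)] -/
theorem moduleFinite_baseChange_congr {X Y : Type*} [AddCommGroup X] [Module (coeffO S) X] [AddCommGroup Y]
    [Module (coeffO S) Y] (e : X ≃ₗ[coeffO S] Y)
    (h : Module.Finite (FractionRing (coeffO S)) (TensorProduct (coeffO S) (FractionRing (coeffO S)) X)) :
    Module.Finite (FractionRing (coeffO S)) (TensorProduct (coeffO S) (FractionRing (coeffO S)) Y) :=
  Module.Finite.equiv (LinearEquiv.baseChange (coeffO S) (FractionRing (coeffO S)) _ _ e)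

/-- The `Module.Finite` clause of (FINX) transports along `CharacterModule.congr`. [cite: Kato2004Asterisque, §13.8 (p. 228)] -/
theorem moduleFinite_characterModule_congr {X Y : Type*} [AddCommGroup X] [Module (coeffO S) X] [AddCommGroup Y]
    [Module (coeffO S) Y] (e : X ≃ₗ[coeffO S] Y)
    (h : Module.Finite (FractionRing (coeffO S)) (TensorProduct (coeffO S) (FractionRing (coeffO S)) (CharacterModule X))) :
    Module.Finite (FractionRing (coeffO S)) (TensorProduct (coeffO S) (FractionRing (coeffO S)) (CharacterModule Y)) :=
  moduleFinite_baseChange_congr S (CharacterModule.congr e) h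

end HIso

/-! ## §2 H-SEL assembled over the pin bundle -/

section HSel

variable (S : Set (PadicAlgCl 2)) (W : WeierstrassCurve ℚ) [W.IsElliptic] (κ : ZpExtension ℚ 2) (γ : absoluteGaloisGroup ℚ)
  (S₀ : Finset (HeightOneSpectrum (𝓞 ℚ))) (n : ℕ) (ρ : FramedGaloisRep ℚ ↥(padicCoeffIntegers S) 2)
  (Θ : ∀ v : HeightOneSpectrum (𝓞 ℚ), ((2 : ℕ) : 𝓞 ℚ) ∈ v.asIdeal → (Cofree ρ ↥(padicCoeffField S) ≃+ (Fin n → ↥(W.geomPrimaryTorsion 2))))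
  (hΘ : ∀ v hv (δ : absoluteGaloisGroup (v.adicCompletion ℚ)) m i,
    Θ v hv (resGalOfEmb (closureEmb (K := ℚ) (v.adicCompletion ℚ)) δ • m) i = resGalOfEmb (closureEmb (K := ℚ) (v.adicCompletion ℚ)) δ • Θ v hv m i)
  (I : Kato2004.IwasawaH1DataCoeff (FramedGaloisRep.toGaloisRep ρ) 2 κ γ)
  (Sg : AddSubgroup (subgroupH1 κ.kerSubgroup (Cofree ρ ↥(padicCoeffField S)))) [Module ↥(padicCoeffIntegers S) ↥Sg]

/-- **H-SEL.** On the habitat of child B / RSL_g (`κ` cyclotomic, `S₀` away from `2`, `Sg` pinned to the signed Selmer set by `hSg`), membership in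
the pinned strict-and-primitive `π.Sel₀` IS membership in the tree's fine Selmer group `Sel₀(ℚ_∞, A_ρ) = GreenbergSelmer.fineSelmerInfty (CofreeF S ρ) κ`:
the pin's at-`2` torsion-Kummer clause is local triviality above `2` (part 1 §4), unramified at `S₀` and outside `2·S₀` is local triviality at
every `w ∤ 2` (part 1 §3), triviality at `∞` is in `Sg`'s definition, and `Sel₀(ℚ_∞, A_ρ)` is «locally trivial everywhere» (part 1 §2).
[cite: Kato2004Asterisque, Thm. 12.5 (2) (p. 222)] [cite: Greenberg1989, §1 p. 98] [cite: Kim2022StructureSelmer, §1.2.4] -/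
theorem mem_Sel₀_iff_mem_fineSelmerInfty (hκ : κ.IsCyclotomic) (hS₀ : ∀ v ∈ S₀, ((2 : ℕ) : 𝓞 ℚ) ∉ v.asIdeal)
    (hSg : ∀ y : H1Γ S κ ρ, y ∈ Sg ↔ y ∈ plusSelmerSet S W κ S₀ n ρ Θ)
    (π : OnePairPins S W κ γ S₀ n ρ Θ hΘ I Sg) (s : ↥Sg) :
    s ∈ π.Sel₀ ↔ (s : H1Γ S κ ρ) ∈ GreenbergSelmer.fineSelmerInfty (CofreeF S ρ) κ := by
  have hs : (s : H1Γ S κ ρ) ∈ plusSelmerSet S W κ S₀ n ρ Θ := (hSg _).1 s.2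
  obtain ⟨hunr, hinf, -⟩ := hs
  rw [π.mem_Sel₀_iff, mem_fineSelmerInfty_iff_locallyTrivial]
  constructor
  · rintro ⟨h2, hS0⟩
    refine ⟨fun v σ ↦ ?_, hinf⟩
    by_cases hv : ((2 : ℕ) : 𝓞 ℚ) ∈ v.asIdeal
    · exact (kummerTorsionAtTwo_iff_mem_awayKer S W κ n ρ Θ hΘ v hv _).1 (h2 v hv σ)
    · exact (forall_awayKer_iff_unramified S κ ρ hκ S₀ hS₀ (s : H1Γ S κ ρ)).2 ⟨hunr, hS0⟩ v hv σ
  · rintro ⟨haw, -⟩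
    exact ⟨fun v hv σ ↦ (kummerTorsionAtTwo_iff_mem_awayKer S W κ n ρ Θ hΘ v hv _).2 (haw v σ),
      ((forall_awayKer_iff_unramified S κ ρ hκ S₀ hS₀ (s : H1Γ S κ ρ)).1 fun w hw σ ↦ haw w σ).2⟩

omit [W.IsElliptic] in
/-- **`Sel₀(ℚ_∞, A_ρ) ⊆ 𝒮` (fine ⟹ signed):** a class locally trivial everywhere lies in the signed Selmer set — unramified outside `2·S₀` by part 1 §3,
trivial at `∞` by definition, and at `v ∣ 2` the PLUS Kummer clause holds with the ZERO points (part 1 `plusKummerClause_of_mem_awayKer`).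
[cite: Greenberg1989, §1 p. 98] [cite: Kobayashi2003, Def. 1.1] -/
theorem mem_plusSelmerSet_of_mem_fineSelmerInfty (hκ : κ.IsCyclotomic) (y : H1Γ S κ ρ)
    (hy : y ∈ GreenbergSelmer.fineSelmerInfty (CofreeF S ρ) κ) : y ∈ plusSelmerSet S W κ S₀ n ρ Θ := by
  rw [mem_fineSelmerInfty_iff_locallyTrivial] at hy
  obtain ⟨haw, hinf⟩ := hy
  refine ⟨(mem_unramifiedOutside_iff _).2 fun v _ hv2 σ ↦ ?_, hinf, fun v hv σ ↦ ?_⟩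
  · rw [unramifiedKer_eq_awayKer_of_isCyclotomic S κ ρ hκ hv2]; exact haw v σ
  · exact plusKummerClause_of_mem_awayKer S W κ n ρ Θ v hv _ (haw v σ)

/-- **H-SEL IN THE PORT'S SHAPE** (k2-g31's (H-SEL, M) signature): `(∃ s ∈ π.Sel₀, ↑s = y) ↔ y ∈ Sel₀(ℚ_∞, A_ρ)` — NO hypothesis beyond the
habitat's (`κ` cyclotomic, `S₀ ∌ 2`, `hSg`). [cite: Kato2004Asterisque, Thm. 12.5 (2) (p. 222)] [cite: Greenberg1989, §1 p. 98] -/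
theorem exists_Sel₀_coe_eq_iff_mem_fineSelmerInfty (hκ : κ.IsCyclotomic) (hS₀ : ∀ v ∈ S₀, ((2 : ℕ) : 𝓞 ℚ) ∉ v.asIdeal)
    (hSg : ∀ y : H1Γ S κ ρ, y ∈ Sg ↔ y ∈ plusSelmerSet S W κ S₀ n ρ Θ)
    (π : OnePairPins S W κ γ S₀ n ρ Θ hΘ I Sg) (y : H1Γ S κ ρ) :
    (∃ s : ↥Sg, s ∈ π.Sel₀ ∧ (s : H1Γ S κ ρ) = y) ↔ y ∈ GreenbergSelmer.fineSelmerInfty (CofreeF S ρ) κ := by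
  constructor
  · rintro ⟨s, hs, rfl⟩
    exact (mem_Sel₀_iff_mem_fineSelmerInfty S W κ γ S₀ n ρ Θ hΘ I Sg hκ hS₀ hSg π s).1 hs
  · intro hy
    have hySg : y ∈ Sg := (hSg y).2 (mem_plusSelmerSet_of_mem_fineSelmerInfty S W κ S₀ n ρ Θ hκ y hy)
    exact ⟨⟨y, hySg⟩, (mem_Sel₀_iff_mem_fineSelmerInfty S W κ γ S₀ n ρ Θ hΘ I Sg hκ hS₀ hSg π ⟨y, hySg⟩).2 hy, rfl⟩

/-- Membership in the image `X := Sel₀.map (Sg ↪ H¹(Γ_∞, A_ρ))` of the pinned submodule, unfolded. [cite: Kato2004Asterisque, Thm. 12.5 (2) (p. 222)] -/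
theorem mem_map_Sel₀_iff (π : OnePairPins S W κ γ S₀ n ρ Θ hΘ I Sg) (y : H1Γ S κ ρ) :
    y ∈ (π.Sel₀.toAddSubgroup).map Sg.subtype ↔ ∃ s : ↥Sg, s ∈ π.Sel₀ ∧ (s : H1Γ S κ ρ) = y := by
  rw [AddSubgroup.mem_map]
  constructor
  · rintro ⟨s, hs, rfl⟩
    exact ⟨s, hs, rfl⟩
  · rintro ⟨s, hs, rfl⟩
    exact ⟨s, hs, rfl⟩

/-- **The port's `hX` binder** for `X := Sel₀.map (Sg ↪ H¹(Γ_∞, A_ρ))`: `y ∈ X ↔ y ∈ Sel₀(ℚ_∞, A_ρ)`.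
[cite: Kato2004Asterisque, Thm. 12.5 (2) (p. 222)] [cite: Greenberg1989, §1 p. 98] -/
theorem mem_map_Sel₀_iff_mem_fineSelmerInfty (hκ : κ.IsCyclotomic) (hS₀ : ∀ v ∈ S₀, ((2 : ℕ) : 𝓞 ℚ) ∉ v.asIdeal)
    (hSg : ∀ y : H1Γ S κ ρ, y ∈ Sg ↔ y ∈ plusSelmerSet S W κ S₀ n ρ Θ)
    (π : OnePairPins S W κ γ S₀ n ρ Θ hΘ I Sg) (y : H1Γ S κ ρ) :
    y ∈ (π.Sel₀.toAddSubgroup).map Sg.subtype ↔ y ∈ GreenbergSelmer.fineSelmerInfty (CofreeF S ρ) κ := by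
  rw [mem_map_Sel₀_iff, exists_Sel₀_coe_eq_iff_mem_fineSelmerInfty S W κ γ S₀ n ρ Θ hΘ I Sg hκ hS₀ hSg π y]

/-! ## §3 The port's `X`-binder: `𝒪`-structure, `hXO`, and the identification with `π.Sel₀` -/

set_option maxHeartbeats 800000 in
/-- **Any admissible `X` is `𝒪`-linearly equivalent to `π.Sel₀`.** If `X ≤ H¹(Γ_∞, A_ρ)` carries an `𝒪`-module structure computed by `scalarH1`
(`hXO`), as does `Sg` (`hSgO`, the registered binder), and `X` has the same members as the image of `π.Sel₀` (`hXmem`), then `↥π.Sel₀ ≃ₗ[𝒪] ↥X`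
(the map `s ↦ ↑s`; stated as an existence so that no definition is introduced). [cite: Kato2004Asterisque, §13.8 (p. 228)] -/
theorem nonempty_linearEquiv_Sel₀_of_mem_iff (π : OnePairPins S W κ γ S₀ n ρ Θ hΘ I Sg)
    (hSgO : ∀ (a : coeffO S) (s : ↥Sg), ((a • s : ↥Sg) : H1Γ S κ ρ) = scalarH1 κ.kerSubgroup (CofreeF S ρ) a s)
    (X : AddSubgroup (H1Γ S κ ρ)) [Module (coeffO S) ↥X]
    (hXO : ∀ (a : coeffO S) (x : ↥X), ((a • x : ↥X) : H1Γ S κ ρ) = scalarH1 κ.kerSubgroup (CofreeF S ρ) a x)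
    (hXmem : ∀ y : H1Γ S κ ρ, y ∈ X ↔ ∃ s : ↥Sg, s ∈ π.Sel₀ ∧ (s : H1Γ S κ ρ) = y) :
    Nonempty (↥π.Sel₀ ≃ₗ[coeffO S] ↥X) := by
  have hmem : ∀ s : ↥π.Sel₀, ((s : ↥Sg) : H1Γ S κ ρ) ∈ X := fun s ↦ (hXmem _).2 ⟨(s : ↥Sg), s.2, rfl⟩
  have hval : ∀ x y : ↥X, (x : H1Γ S κ ρ) = (y : H1Γ S κ ρ) → x = y := fun x y h ↦ Subtype.ext h
  -- the `𝒪`-linear map `s ↦ ↑↑s` (additivity by the coercion lemmas, `𝒪`-linearity by `hSgO`/`hXO`)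
  let f : ↥π.Sel₀ →ₗ[coeffO S] ↥X :=
    { toFun := fun s ↦ ⟨((s : ↥Sg) : H1Γ S κ ρ), hmem s⟩
      map_add' := fun a b ↦ hval _ _ (by
        simp only [Submodule.coe_add, AddSubgroup.coe_add])
      map_smul' := fun a s ↦ hval _ _ (by
        change (((a • s : ↥π.Sel₀) : ↥Sg) : H1Γ S κ ρ) =
          ((a • (⟨((s : ↥Sg) : H1Γ S κ ρ), hmem s⟩ : ↥X) : ↥X) : H1Γ S κ ρ)
        rw [Submodule.coe_smul, hSgO, hXO]) }
  have hf_coe : ∀ s : ↥π.Sel₀, ((f s : ↥X) : H1Γ S κ ρ) = ((s : ↥Sg) : H1Γ S κ ρ) := fun _ ↦ rfl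
  have hf : Function.Bijective f := by
    constructor
    · intro a b hab
      have h := congrArg (fun x : ↥X ↦ (x : H1Γ S κ ρ)) hab
      simp only [hf_coe] at h
      exact Subtype.ext (Subtype.ext h)
    · rintro ⟨x, hx⟩
      obtain ⟨s, hs, hsx⟩ := (hXmem x).1 hx
      exact ⟨⟨s, hs⟩, Subtype.ext hsx⟩
  exact ⟨LinearEquiv.ofBijective f hf⟩

/-- **H-ISO applied**: for any admissible `X` (as in `nonempty_linearEquiv_Sel₀_of_mem_iff`), `λ_𝒪(X^∨) = λ_𝒪((π.Sel₀)^∨)` — turns the (LAM)/(FINX)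
right-hand side of the «Kato125AB» text into child B's. [cite: Kato2004Asterisque, §13.8 (p. 228)] -/
theorem lamO_characterModule_eq_of_mem_iff (π : OnePairPins S W κ γ S₀ n ρ Θ hΘ I Sg)
    (hSgO : ∀ (a : coeffO S) (s : ↥Sg), ((a • s : ↥Sg) : H1Γ S κ ρ) = scalarH1 κ.kerSubgroup (CofreeF S ρ) a s)
    (X : AddSubgroup (H1Γ S κ ρ)) [Module (coeffO S) ↥X]
    (hXO : ∀ (a : coeffO S) (x : ↥X), ((a • x : ↥X) : H1Γ S κ ρ) = scalarH1 κ.kerSubgroup (CofreeF S ρ) a x)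
    (hXmem : ∀ y : H1Γ S κ ρ, y ∈ X ↔ ∃ s : ↥Sg, s ∈ π.Sel₀ ∧ (s : H1Γ S κ ρ) = y) :
    lamO S (CharacterModule ↥X) = lamO S (CharacterModule ↥π.Sel₀) := by
  obtain ⟨e⟩ := nonempty_linearEquiv_Sel₀_of_mem_iff S W κ γ S₀ n ρ Θ hΘ I Sg π hSgO X hXO hXmem
  exact (lamO_characterModule_congr S e).symm

set_option maxHeartbeats 800000 in
/-- **The port's `X`-binder exists**: the image `X := Sel₀.map (Sg ↪ H¹(Γ_∞, A_ρ))` carries an `𝒪`-module structure whose scalars are computed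
by `scalarH1` on classes (the «Kato125AB» `hXO` clause — transported from `↥π.Sel₀` along `s ↦ ↑s`, `AddEquiv.module`), together with an
`𝒪`-linear equivalence `↥π.Sel₀ ≃ₗ[𝒪] ↥X`. Stated as an existence so that no definition is introduced; consume with
`obtain ⟨inst, hXO, ⟨e⟩⟩ := …; letI := inst`. [cite: Kato2004Asterisque, §13.8 (p. 228)] [cite: EmertonPollackWeston2006, §3.1] -/
theorem exists_module_map_Sel₀ (π : OnePairPins S W κ γ S₀ n ρ Θ hΘ I Sg)
    (hSgO : ∀ (a : coeffO S) (s : ↥Sg), ((a • s : ↥Sg) : H1Γ S κ ρ) = scalarH1 κ.kerSubgroup (CofreeF S ρ) a s) :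
    ∃ inst : Module (coeffO S) ↥((π.Sel₀.toAddSubgroup).map Sg.subtype),
      (letI := inst
       (∀ (a : coeffO S) (x : ↥((π.Sel₀.toAddSubgroup).map Sg.subtype)),
          ((a • x : ↥((π.Sel₀.toAddSubgroup).map Sg.subtype)) : H1Γ S κ ρ) = scalarH1 κ.kerSubgroup (CofreeF S ρ) a x) ∧
        Nonempty (↥π.Sel₀ ≃ₗ[coeffO S] ↥((π.Sel₀.toAddSubgroup).map Sg.subtype))) := by
  have hmem : ∀ s : ↥π.Sel₀, ((s : ↥Sg) : H1Γ S κ ρ) ∈ (π.Sel₀.toAddSubgroup).map Sg.subtype :=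
    fun s ↦ AddSubgroup.mem_map.2 ⟨(s : ↥Sg), s.2, rfl⟩
  have hval : ∀ x y : ↥((π.Sel₀.toAddSubgroup).map Sg.subtype), (x : H1Γ S κ ρ) = (y : H1Γ S κ ρ) → x = y :=
    fun x y h ↦ Subtype.ext h
  -- the additive bijection `s ↦ ↑↑s : ↥π.Sel₀ → ↥X`
  let g : ↥π.Sel₀ →+ ↥((π.Sel₀.toAddSubgroup).map Sg.subtype) :=
    AddMonoidHom.mk' (fun s ↦ ⟨((s : ↥Sg) : H1Γ S κ ρ), hmem s⟩) (fun a b ↦ hval _ _ (by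
      simp only [Submodule.coe_add, AddSubgroup.coe_add]))
  have hg_coe : ∀ s : ↥π.Sel₀, ((g s : ↥((π.Sel₀.toAddSubgroup).map Sg.subtype)) : H1Γ S κ ρ) = ((s : ↥Sg) : H1Γ S κ ρ) :=
    fun _ ↦ rfl
  have hg : Function.Bijective g := by
    constructor
    · intro a b hab
      have h := congrArg (fun x : ↥((π.Sel₀.toAddSubgroup).map Sg.subtype) ↦ (x : H1Γ S κ ρ)) hab
      simp only [hg_coe] at h
      exact Subtype.ext (Subtype.ext h)
    · rintro ⟨x, hx⟩
      obtain ⟨s, hs, hsx⟩ := AddSubgroup.mem_map.1 hx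
      exact ⟨⟨s, hs⟩, Subtype.ext hsx⟩
  -- transport the `𝒪`-module structure of `↥π.Sel₀` along the inverse bijection
  let e : ↥((π.Sel₀.toAddSubgroup).map Sg.subtype) ≃+ ↥π.Sel₀ := (AddEquiv.ofBijective g hg).symm
  have hge : ∀ x, g (e x) = x := fun x ↦ AddEquiv.ofBijective_apply_symm_apply g hg
  have he_coe : ∀ x : ↥((π.Sel₀.toAddSubgroup).map Sg.subtype), (((e x : ↥π.Sel₀) : ↥Sg) : H1Γ S κ ρ) = (x : H1Γ S κ ρ) :=
    fun x ↦ by rw [← hg_coe, hge]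
  refine ⟨e.module (coeffO S), ?_, ?_⟩
  · letI := e.module (coeffO S)
    intro a x
    have h1 : (a • x : ↥((π.Sel₀.toAddSubgroup).map Sg.subtype)) = e.symm (a • e x) := rfl
    have h2 : e.symm (a • e x) = g (a • e x) := rfl
    rw [h1, h2, hg_coe, Submodule.coe_smul, hSgO, he_coe]
  · letI := e.module (coeffO S)
    exact ⟨(e.linearEquiv (coeffO S)).symm⟩

end HSel

/-! ## §4 The `μt := 1` arithmetic and the adapter (k2-g31 B1–B4) -/

section Adapter

variable {S : Set (PadicAlgCl 2)} {κ : ZpExtension ℚ 2} {γ : absoluteGaloisGroup ℚ}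
  {ρ : FramedGaloisRep ℚ ↥(padicCoeffIntegers S) 2}

/-- (B1) The (FIN)/(LAM) left-hand side of the «Kato125AB» text is DEFINITIONALLY child B's `lamO S (zetaQuot I z)`.
[cite: Kato2004Asterisque, Thm. 12.5 (2) (p. 222)] -/
theorem lamO_zetaQuot_eq (I : Kato2004.IwasawaH1DataCoeff (FramedGaloisRep.toGaloisRep ρ) 2 κ γ) [Module (coeffO S) I.H]
    [IsScalarTower (coeffO S) (IwasawaAlgebraO S) I.H] (z : I.H) :
    lamO S (zetaQuot I z) =
      Module.finrank (FractionRing (coeffO S))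
        (TensorProduct (coeffO S) (FractionRing (coeffO S)) (I.H ⧸ Submodule.span (IwasawaAlgebraO S) ({z} : Set I.H))) :=
  rfl

/-- (B2) `λ_𝒪` of a trivial module is `0` (every tensor vanishes). [cite: Kato2004Asterisque, §13.8 (p. 228)] -/
theorem lamO_eq_zero_of_subsingleton (X : Type*) [AddCommGroup X] [Module (coeffO S) X] [Subsingleton X] : lamO S X = 0 := by
  haveI : Subsingleton (TensorProduct (coeffO S) (FractionRing (coeffO S)) X) := by
    refine ⟨fun x y ↦ ?_⟩
    have hx : ∀ t : TensorProduct (coeffO S) (FractionRing (coeffO S)) X, t = 0 := by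
      intro t
      induction t using TensorProduct.induction_on with
      | zero => rfl
      | tmul a b => rw [Subsingleton.elim b 0, TensorProduct.tmul_zero]
      | add a b ha hb => rw [ha, hb, add_zero]
    rw [hx x, hx y]
  exact Module.finrank_zero_of_subsingleton

/-- (B3) Child B's `Λ`-multiplier slack VANISHES at `μt := 1`: `λ_𝒪(Λ_𝒪 ⧸ (1)) = 0`. [cite: Kato2004Asterisque, §13.8 (p. 228)] -/
theorem lamO_quot_span_one_eq_zero :
    lamO S (IwasawaAlgebraO S ⧸ Ideal.span ({(1 : IwasawaAlgebraO S)} : Set (IwasawaAlgebraO S))) = 0 := by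
  haveI : Subsingleton (IwasawaAlgebraO S ⧸ Ideal.span ({(1 : IwasawaAlgebraO S)} : Set (IwasawaAlgebraO S))) :=
    Ideal.Quotient.subsingleton_iff.mpr Ideal.span_singleton_one
  exact lamO_eq_zero_of_subsingleton _

/-- (B4) From `a ≤ b` to child B's registered right-hand side shape `a ≤ b + λ_𝒪(Λ_𝒪/(1))`. [cite: Kato2004Asterisque, §13.8 (p. 228)] -/
theorem childB_rhs_of_le {a b : ℕ} (h : a ≤ b) :
    a ≤ b + lamO S (IwasawaAlgebraO S ⧸ Ideal.span ({(1 : IwasawaAlgebraO S)} : Set (IwasawaAlgebraO S))) := by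
  rw [lamO_quot_span_one_eq_zero, add_zero]; exact h

variable (S κ γ ρ) (W : WeierstrassCurve ℚ) [W.IsElliptic] (S₀ : Finset (HeightOneSpectrum (𝓞 ℚ))) (n : ℕ)
  (Θ : ∀ v : HeightOneSpectrum (𝓞 ℚ), ((2 : ℕ) : 𝓞 ℚ) ∈ v.asIdeal → (Cofree ρ ↥(padicCoeffField S) ≃+ (Fin n → ↥(W.geomPrimaryTorsion 2))))
  (hΘ : ∀ v hv (δ : absoluteGaloisGroup (v.adicCompletion ℚ)) m i,
    Θ v hv (resGalOfEmb (closureEmb (K := ℚ) (v.adicCompletion ℚ)) δ • m) i = resGalOfEmb (closureEmb (K := ℚ) (v.adicCompletion ℚ)) δ • Θ v hv m i)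
  (I : Kato2004.IwasawaH1DataCoeff (FramedGaloisRep.toGaloisRep ρ) 2 κ γ)
  (Sg : AddSubgroup (subgroupH1 κ.kerSubgroup (Cofree ρ ↥(padicCoeffField S)))) [Module ↥(padicCoeffIntegers S) ↥Sg]

/-- **THE ADAPTER (k2-g31 Plan 2, child B's half).** From the merged fact's clauses about a class `z` — (FIN) the zeta quotient `𝐇¹ ⧸ Λ_𝒪 z` is
finite-dimensional after `Frac 𝒪 ⊗_𝒪 –` and (LAM) `finrank (Frac 𝒪 ⊗ (𝐇¹ ⧸ Λ_𝒪 z)) ≤ finrank (Frac 𝒪 ⊗ X^∨)` for an `X` with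
`λ_𝒪(X^∨) = λ_𝒪((π.Sel₀)^∨)` (§3) — to child B's registered clauses at `(z, μt := 1)`: (ii_fin) verbatim and
(ii_λ) `λ_𝒪(𝐇¹/Λ_𝒪 z) ≤ λ_𝒪((π.Sel₀)^∨) + λ_𝒪(Λ_𝒪 ⧸ (1))`. [cite: Kato2004Asterisque, Thm. 12.5 (2) (p. 222)] [cite: BurungaleTian2026, Thm. 2.6 (p. 5)] -/
theorem childB_clauses_of_fin_lam [Module (coeffO S) I.H] [IsScalarTower (coeffO S) (IwasawaAlgebraO S) I.H]
    (π : OnePairPins S W κ γ S₀ n ρ Θ hΘ I Sg) (z : I.H) {X : Type*} [AddCommGroup X] [Module (coeffO S) X]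
    (hXlam : lamO S (CharacterModule X) = lamO S (CharacterModule ↥π.Sel₀))
    (hFIN : Module.Finite (FractionRing (coeffO S))
      (TensorProduct (coeffO S) (FractionRing (coeffO S)) (I.H ⧸ Submodule.span (IwasawaAlgebraO S) ({z} : Set I.H))))
    (hLAM : Module.finrank (FractionRing (coeffO S))
        (TensorProduct (coeffO S) (FractionRing (coeffO S)) (I.H ⧸ Submodule.span (IwasawaAlgebraO S) ({z} : Set I.H))) ≤
      Module.finrank (FractionRing (coeffO S)) (TensorProduct (coeffO S) (FractionRing (coeffO S)) (CharacterModule X))) :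
    Module.Finite (FractionRing (coeffO S)) (TensorProduct (coeffO S) (FractionRing (coeffO S)) (zetaQuot I z)) ∧
      lamO S (zetaQuot I z) ≤ lamO S (CharacterModule ↥π.Sel₀) +
        lamO S (IwasawaAlgebraO S ⧸ Ideal.span ({(1 : IwasawaAlgebraO S)} : Set (IwasawaAlgebraO S))) := by
  refine ⟨hFIN, childB_rhs_of_le ?_⟩
  rw [lamO_zetaQuot_eq, ← hXlam, lamO_eq]
  exact hLAM

end Adapter

end Summit.BirchSwinnertonDyer.BirchSwinnertonDyer.Theorems.OnePair.ChildBKit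

end
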